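import Literature.MathematicalPhysics.QuantumFieldTheory.Balaban1983to89.B9SectBCodedChainAn
import Literature.MathematicalPhysics.QuantumFieldTheory.Balaban1983to89.Node00.OpsYULetters
import Literature.MathematicalPhysics.QuantumFieldTheory.Balaban1983to89.B9SectBH1ReadWriteY

/-!
# `Balaban1983to89.B9SectBCodedReadingsU` — THE U-LETTER CODED READINGS `KSCU` (site, G′) ∕ `KACU` (bond, G) OVER THE CODED CARRIER and THE ROW-13 TARGET OF
# RECORD IN PRINT's READING: Sect. B ∕ Theorem 3.4 for `(KSCU, KACU, C⁻¹, IsAnKY)` — node00-def-Y's ruling R13-U1 on LOCATED-11 (letters at the base `U`,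
# operator at the product `U′U`; `Node00.OpsYULetters.kernelFamilySU∕BU`)

T. Bałaban, *Propagators for lattice gauge theories in a background field*, Commun. Math. Phys. **99** (1985) 389–434
[`Balaban1985BackgroundPropagators`, "B9"]; [4] = T. Bałaban, *Propagators and renormalization transformations for lattice gauge
theories. II*, Commun. Math. Phys. **96** (1984) 223–250 [`Balaban1984PropagatorsII`].

statement-level skeleton of published theorems with citation tags; proofs where landed; nothing here is a claim about the
Yang–Mills mass gap

THE PRINTED LOCI.  Theorem 3.4 p. 400 and its proof pp. 400–407 in the norms OF `U` ((3.54) p. 401, (3.61)–(3.64) p. 402, p. 403 l.4–7); (3.39)–(3.47) pp. 397–398.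

WHY THIS FILE (seat dag-n06-c gen 11; LOCATED-11 (bus 2026-08-28) and node00-def-Y g22's RULING: R13-U1 ADOPTED, FILE 45 `Node00/OpsYULetters` p629583).
The record's row-13 statement `B9.SectBStepPrinted … (ops x).Gp (ops x).GA (ops x).Cinv …` over `bg9Y` reads the OUTPUT blocks at the complex product `U′U` in
W-LETTERS (transporters `parSymY (U′U)`), which is unbounded for the Hölder members (LOCATED-11); print's Theorem 3.4 is in U-letters.  The reading of record for
products is therefore the TWO-CONFIGURATION reader over a carrier remembering `U` — the coded carrier `codingYx` (`CCfg.prod U a`) with def-Y's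
`kernelFamilySU∕BU` (letters at `baseY`, operator at `decY`).  THIS FILE: §1 ★ `KSCU` (site sector, `G′`: `kernelFamilySU … baseY decY (GpY par) par`), ★ `KACU`
(bond sector, `G`: `kernelFamilyBU … baseY decY OA parB`), the rfl faces (`KSCU_h1_inl` = `B9SectBH1ReadWriteY.h1ReadT (G′(dec c)) (par (base c)) (base c)`; at a base
configuration every member IS the record's — def-Y's `_congr`); §2 ★★ the ROW-13 TARGETS OF RECORD
as named statements: `SectBStepU` = `B9.SectBStepPrinted dC c35 (geo9Y∘f) (codingYx …).bg (KSCU∘f) (KACU∘f) (pullS Cinv) IsAnKY` and `Thm34U` = `B9.Thm34Printed …`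
likewise — print's Sect. B ∕ Theorem 3.4 for the subfamily `f`, to be displayed ∕ discharged by the certificate editions in place of the W-letter `hB`.
HONEST SCOPE.  Definitions and rfl bookkeeping; nothing of [B9] asserted (the targets are `Prop`s, not theorems); COUNT-NEUTRAL; N06 NOT discharged; one finite
lattice programme — nothing continuum, nothing about OS positivity or the mass gap.
-/

noncomputable section

namespace Literature.MathematicalPhysics.QuantumFieldTheory.Balaban1983to89.B9SectBCodedReadingsU

open Literature.MathematicalPhysics.QuantumFieldTheory.Balaban1983to89.B6Ineq2142KLevelV1 (β)
open Literature.MathematicalPhysics.QuantumFieldTheory.Balaban1983to89.B9FromB6 (EBlock)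
open Literature.MathematicalPhysics.QuantumFieldTheory.Balaban1983to89.B9SectBCodedCarrier (CCfg Coding pullK pullS)
open Literature.MathematicalPhysics.QuantumFieldTheory.Balaban1983to89.B9Eq360DeltaPrimeAY (AfldY)
open Literature.MathematicalPhysics.QuantumFieldTheory.Balaban1983to89.B9PinMembersKLevelV1 (MemberY geo9Y bg9Y)
open Literature.MathematicalPhysics.QuantumFieldTheory.Balaban1983to89.B9SectBGpLettersY (GVal decY)
open Literature.MathematicalPhysics.QuantumFieldTheory.Balaban1983to89.B9SectBGpFrameCodedY (codingYx)
open Literature.MathematicalPhysics.QuantumFieldTheory.Balaban1983to89.B9SectBGpReadingsY (KSC baseY)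
open Literature.MathematicalPhysics.QuantumFieldTheory.Balaban1983to89.B9SectBCodedChainAn (IsAnKY)
open Literature.MathematicalPhysics.QuantumFieldTheory.Balaban1983to89.B9SectBH1ReadWriteY (h1ReadT)
open Literature.MathematicalPhysics.QuantumFieldTheory.Balaban1983to89.Node00 (SiteY BlkY FBondY IBondY CfgY SiteParY BondParY SiteOpY BondOpY kernelFamilyS
  kernelFamilyB GpY)
open Literature.MathematicalPhysics.QuantumFieldTheory.Balaban1983to89.Node00.OpsYULetters (kernelFamilySU kernelFamilyBU)

variable {d ℓ : ℕ} {hd : 1 ≤ d + 1} {hL : Odd (ℓ + 1) ∧ 1 < ℓ + 1} {b₀ b₁ : ℝ} {Mstar : ℕ}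
variable {𝔸 : Type} [NormedRing 𝔸] [NormedAlgebra ℂ 𝔸] [CompleteSpace 𝔸]

/-! ## §1 The U-letter coded readings -/

section Readings

variable (G : Subgroup 𝔸ˣ) (x : MemberY d ℓ hd hL b₀ b₁ Mstar) (par : SiteParY 𝔸 x.toKIdx) (OA : BondOpY 𝔸 x.toKIdx) (parB : BondParY 𝔸 x.toKIdx)
  (C37 C38 : ℝ → CfgY 𝔸 x.toKIdx → AfldY 𝔸 x.toKIdx → Prop)

/-- ★ **`KSCU` — THE SITE-SECTOR (G′) READING OF RECORD OVER THE CODED CARRIER, U-LETTERS**: def-Y's two-configuration reader with the letters (`∇_U`, `∇*_U`,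
`Δ_U`, the transporter) at the BASE of the coded configuration and the operator `G′` at its DECODING (`G′(U′U)` at a product).
[cite: Balaban1985BackgroundPropagators, Thm 3.4 p.400, (3.42)–(3.47) pp.397–398, p.403 l.4–7] -/
def KSCU : B9.KernelFamily (geo9Y x) (codingYx G x C37 C38).bg :=
  kernelFamilySU x.toKIdx (codingYx G x C37 C38).bg (baseY x.toKIdx) (decY x.toKIdx) (GpY x.toKIdx par) par

/-- ★ **`KACU` — THE BOND-SECTOR (G) READING OF RECORD OVER THE CODED CARRIER, U-LETTERS** (bond letters `OA`, `parB` of the record as parameters).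
[cite: Balaban1985BackgroundPropagators, Thm 3.4 p.400, (3.84)–(3.86) p.407, (3.42)–(3.47) pp.397–398] -/
def KACU : B9.KernelFamily (geo9Y x) (codingYx G x C37 C38).bg :=
  kernelFamilyBU x.toKIdx (codingYx G x C37 C38).bg (baseY x.toKIdx) (decY x.toKIdx) OA parB

/-- the (3.43) member of `KSCU` IS the U-letter reading `h1ReadT (G′(dec c)) (par (base c)) (base c)` of `B9SectBH1ReadWriteY` (rfl) — the READ∕WRITE dictionary applies.
[cite: Balaban1985BackgroundPropagators, (3.43) p.398, bookkeeping] -/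
theorem KSCU_h1_inl (c : (codingYx G x C37 C38).bg.Cfg) (f : SiteY x.toKIdx → ℝ) (α : ℝ) (z : SiteY x.toKIdx → ℝ) :
    (KSCU G x par C37 C38).h1 c (.inl f) α (.inl z) =
      h1ReadT x.toKIdx (GpY x.toKIdx par (decY x.toKIdx c)) (par (baseY x.toKIdx c)) (baseY x.toKIdx c) f α z := rfl

end Readings

/-! ## §2 The row-13 targets of record in print's reading (U-letters at products) -/

section Targets

variable {J : Type} (f : J → MemberY d ℓ hd hL b₀ b₁ Mstar) (dC : ℕ) (c35 : ℝ) (G : Subgroup 𝔸ˣ) {ι : Type} [Fintype ι] (b : Module.Basis ι ℝ 𝔸)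
  (par : ∀ j : J, SiteParY 𝔸 (f j).toKIdx) (OA : ∀ j : J, BondOpY 𝔸 (f j).toKIdx) (parB : ∀ j : J, BondParY 𝔸 (f j).toKIdx)
  (C37 C38 : ∀ j : J, ℝ → CfgY 𝔸 (f j).toKIdx → AfldY 𝔸 (f j).toKIdx → Prop)
  (Cinv : ∀ j : J, B9.SiteKernel (geo9Y (f j)) (bg9Y 𝔸 G (f j)))

/-- ★★ **THE SECT.-B STEP OF RECORD, PRINT's READING (R13-U1), ON A SUBFAMILY `f`**: `B9.SectBStepPrinted` over the coded carriers `codingYx` for the U-letter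
readings `KSCU` (G′), `KACU` (G), the record's (3.48) kernel read along the decoding, and the coded analyticity predicate `IsAnKY` — the statement the certificate's
row 13 displays ∕ discharges in place of the W-letter `hB` (LOCATED-11). A `Prop`; nothing asserted. [cite: Balaban1985BackgroundPropagators, Thm 3.4 p.400, Sect. B pp.400–407] -/
def SectBStepU : Prop :=
  B9.SectBStepPrinted dC c35 (fun j => geo9Y (f j)) (fun j => (codingYx G (f j) (C37 j) (C38 j)).bg)
    (fun j => KSCU G (f j) (par j) (C37 j) (C38 j)) (fun j => KACU G (f j) (OA j) (parB j) (C37 j) (C38 j))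
    (fun j => pullS (codingYx G (f j) (C37 j) (C38 j)) (Cinv j)) (fun j => IsAnKY G (f j) (par j) b (C37 j) (C38 j))

/-- ★★ **THEOREM 3.4 OF RECORD, PRINT's READING (R13-U1), ON A SUBFAMILY `f`**: `B9.Thm34Printed` over the coded carriers for `(KSCU, KACU, IsAnKY)`. A `Prop`;
nothing asserted. [cite: Balaban1985BackgroundPropagators, Thm 3.4 p.400] -/
def Thm34U : Prop :=
  B9.Thm34Printed c35 (fun j => geo9Y (f j)) (fun j => (codingYx G (f j) (C37 j) (C38 j)).bg)
    (fun j => KSCU G (f j) (par j) (C37 j) (C38 j)) (fun j => KACU G (f j) (OA j) (parB j) (C37 j) (C38 j))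
    (fun j => IsAnKY G (f j) (par j) b (C37 j) (C38 j))

end Targets

end Literature.MathematicalPhysics.QuantumFieldTheory.Balaban1983to89.B9SectBCodedReadingsU

end
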